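import Mathlib
import Literature.NumberTheory.Transcendental.MahlerManinEndgame

/-!
# Super-polynomial decay of `e^{s²}` under vertical escape — crux stmt-Schanuel-0969

Route `RigidCore`, crux (S*) `MinimalCounterexampleInAcl` (item stmt-Schanuel-0969), line
`kernel-arithmetic-selection` (skeleton gen 19, lead prover-line-stmt-Schanuel-0969-c6-0), stub **Q**
(`stub_quadExpDecay`), landed `--supports stmt-Schanuel-0969`.

Along the mates of a rank-2 first failure both `‖e^{s}‖` and `‖e^{-s}‖` are polynomially bounded in `‖s‖`
(`s` = first coordinate).  This file turns that into decay of the second-level exponential `e^{s²}` faster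
than any polynomial: if `‖e^{±s}‖ ≤ C (1+‖s‖)^D` then `|Re s| ≤ log (C (1+‖s‖)^D) = log C + D log (1+‖s‖)`
(`Complex.norm_exp`, `Real.le_log_iff_exp_le`), while `‖e^{s²}‖ = exp (Re (s²))` with
`Re (s²) = (Re s)² − (Im s)² = 2 (Re s)² − ‖s‖²`; hence
`‖e^{s²}‖ (1+‖s‖)^M = exp (2 (Re s)² − ‖s‖² + M log (1+‖s‖)) ≤ exp (2 (log C + D log u)² + M log u − ‖s‖²)`
with `u = 1 + ‖s‖`, and the exponent is `≤ 0` once `‖s‖ ≥ 4 (log C)² + 2 (16 D² + M) + 1`, using the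
elementary bounds `log u ≤ u` and `(log u)² ≤ 4 u` for `u ≥ 1` (the latter is the already-landed
`Literature.NumberTheory.Transcendental.log_sq_le_four_mul`, reused rather than restated).

Pure real/complex analysis; Mathlib plus that one Literature lemma.
-/

noncomputable section

set_option linter.dupNamespace false

open Complex
open Literature.NumberTheory.Transcendental (log_sq_le_four_mul)

namespace Summit.Schanuel.Schanuel.Cruxes.MinimalCounterexampleInAcl.KernelArithmeticSelection

/-- The real inequality behind stub Q: for `r ≥ 4 a² + 2 (16 D² + M) + 1` (and `r ≥ 0`) one has
`2 (a + D log (1+r))² + M log (1+r) ≤ r²`. -/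
theorem two_mul_sq_add_mul_log_le_sq (a : ℝ) (D M : ℕ) {r : ℝ} (hr0 : 0 ≤ r)
    (hr : 4 * a ^ 2 + 2 * (16 * (D : ℝ) ^ 2 + M) + 1 ≤ r) :
    2 * (a + D * Real.log (1 + r)) ^ 2 + M * Real.log (1 + r) ≤ r ^ 2 := by
  have hu1 : 1 ≤ 1 + r := by linarith
  have hlu0 : 0 ≤ Real.log (1 + r) := Real.log_nonneg hu1
  have hlu1 : Real.log (1 + r) ≤ 1 + r :=
    (Real.log_le_sub_one_of_pos (by linarith)).trans (by linarith)
  have hlu2 : Real.log (1 + r) ^ 2 ≤ 4 * (1 + r) := log_sq_le_four_mul hu1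
  have hD0 : (0 : ℝ) ≤ (D : ℝ) ^ 2 := sq_nonneg _
  have hM0 : (0 : ℝ) ≤ (M : ℝ) := Nat.cast_nonneg M
  -- `2 (a + D L)² ≤ 4 a² + 4 D² L²`
  have h1 : 2 * (a + D * Real.log (1 + r)) ^ 2 ≤ 4 * a ^ 2 + 4 * (D : ℝ) ^ 2 * Real.log (1 + r) ^ 2 := by
    nlinarith [sq_nonneg (a - D * Real.log (1 + r))]
  -- `4 D² L² ≤ 16 D² (1+r)` and `M L ≤ M (1+r)`
  have h2 : 4 * (D : ℝ) ^ 2 * Real.log (1 + r) ^ 2 ≤ 16 * (D : ℝ) ^ 2 * (1 + r) := by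
    nlinarith [mul_le_mul_of_nonneg_left hlu2 hD0]
  have h3 : (M : ℝ) * Real.log (1 + r) ≤ M * (1 + r) := mul_le_mul_of_nonneg_left hlu1 hM0
  -- the final polynomial inequality `4 a² + K (1 + r) ≤ r²`, `K = 16 D² + M`
  have hK0 : (0 : ℝ) ≤ 16 * (D : ℝ) ^ 2 + M := by positivity
  have hr1 : 1 ≤ r := by nlinarith [sq_nonneg a]
  have h4 : (4 * a ^ 2 + 2 * (16 * (D : ℝ) ^ 2 + M) + 1) * r ≤ r * r :=
    mul_le_mul_of_nonneg_right hr hr0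
  nlinarith [mul_le_mul_of_nonneg_left hr1 (mul_nonneg (by norm_num : (0 : ℝ) ≤ 4) (sq_nonneg a)),
    mul_le_mul_of_nonneg_left hr1 hK0]

/-- **Stub Q — SUPER-POLYNOMIAL DECAY OF `e^{s²}` UNDER VERTICAL ESCAPE (analysis).**  If `‖e^{±s}‖ ≤ C(1+‖s‖)^D` then
`|Re s| ≤ log (C(1+‖s‖)^D)` and `Re(s²) = 2(Re s)² − ‖s‖²`, so `‖e^{s²}‖ (1+‖s‖)^M ≤ exp(2 log²(C(1+‖s‖)^D) + M log(1+‖s‖) − ‖s‖²) ≤ 1`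
for `‖s‖ ≥ R(C, D, M)`; explicitly `R = 4 (log C)² + 2 (16 D² + M) + 1` works. -/
theorem stub_quadExpDecay : ∀ (C : ℝ) (D M : ℕ), 0 < C → ∃ R : ℝ, ∀ s : ℂ, R ≤ ‖s‖ → ‖Complex.exp s‖ ≤ C * (1 + ‖s‖) ^ D → ‖Complex.exp (-s)‖ ≤ C * (1 + ‖s‖) ^ D → ‖Complex.exp (s ^ 2)‖ * (1 + ‖s‖) ^ M ≤ 1 := by
  intro C D M hC
  refine ⟨4 * Real.log C ^ 2 + 2 * (16 * (D : ℝ) ^ 2 + M) + 1, fun s hs h₁ h₂ => ?_⟩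
  have hr0 : 0 ≤ ‖s‖ := norm_nonneg s
  have hu0 : 0 < 1 + ‖s‖ := by linarith
  have hB : 0 < C * (1 + ‖s‖) ^ D := by positivity
  -- the two hypotheses bound `|Re s|` by `log (C (1+‖s‖)^D) = log C + D log (1+‖s‖)`
  rw [Complex.norm_exp] at h₁ h₂
  have hlog : Real.log (C * (1 + ‖s‖) ^ D) = Real.log C + D * Real.log (1 + ‖s‖) := by
    rw [Real.log_mul hC.ne' (pow_pos hu0 D).ne', Real.log_pow]
  have hre₁ : s.re ≤ Real.log C + D * Real.log (1 + ‖s‖) :=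
    hlog ▸ (Real.le_log_iff_exp_le hB).2 h₁
  have hre₂ : -s.re ≤ Real.log C + D * Real.log (1 + ‖s‖) := by
    have h := (Real.le_log_iff_exp_le hB).2 h₂
    rw [hlog] at h
    simpa using h
  have hsq : s.re ^ 2 ≤ (Real.log C + D * Real.log (1 + ‖s‖)) ^ 2 := sq_le_sq' (by linarith) hre₁
  -- `Re (s²) = (Re s)² − (Im s)² = 2 (Re s)² − ‖s‖²`
  have hre : (s ^ 2).re = 2 * s.re ^ 2 - ‖s‖ ^ 2 := by
    have him : ‖s‖ ^ 2 - s.re ^ 2 = s.im ^ 2 := Complex.sq_norm_sub_sq_re s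
    rw [sq, Complex.mul_re]
    nlinarith [him]
  -- everything as one real exponential
  have hpow : (1 + ‖s‖) ^ M = Real.exp (M * Real.log (1 + ‖s‖)) := by
    rw [Real.exp_nat_mul, Real.exp_log hu0]
  have hmain := two_mul_sq_add_mul_log_le_sq (Real.log C) D M hr0 hs
  rw [Complex.norm_exp, hpow, ← Real.exp_add, Real.exp_le_one_iff, hre]
  nlinarith [hmain, hsq]

end Summit.Schanuel.Schanuel.Cruxes.MinimalCounterexampleInAcl.KernelArithmeticSelection

end
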